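import Summits.CriticalPhenomena.PercolationContinuityZ3.Theorems.SahiMasterFamilyFiveStep

/-!
# Shrunk frames at order four: two positivity classes for `E_4` beyond "contains a `Z_3` sub-triple"

Unit `prim-master-conj` (crux anchor stmt-CriticalPhenomena-4575); companion of `SahiMasterFamilyFourStep.lean` /
`SahiMasterFamilyFiveStep.lean`.  The order-five step peeled at the free slot `W` produces order-four families
`(G, D, X ∩ W, Y)` that need NOT contain a `Z_3` sub-triple (K4-NOTES §11 of the unit); their positivity is the input of the
(EQ-5) zero analysis.  PROVED here, for every product measure and arbitrary increasing `X'`: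
* `sahiE_four_eq_of_two_shrinks` (any weight): if `g = k − n`, `d = k' − n'` with `n, n'` killing `x` and `y`, then
  `E_4(g,d,x,y) = E_4(k,k',x,y) + E(n)E_3(k',x,y) + E(n')E_3(k,x,y) + [E(k'n) + E(kn') + E(n)E(n') − E(nn')]·E_2(x,y)`;
* `sahiE_four_ind_nonneg_of_two_shrinks`: for increasing `G ⊆ K`, `D ⊆ K'`, `X'`, `Y` with `Y, K, K'` of pairwise disjoint
  essential supports and `X' ∩ K ⊆ G ⊇ Y ∩ K`, `X' ∩ K' ⊆ D ⊇ Y ∩ K'` (the removed parts `K ∖ G`, `K' ∖ D` miss `X'` and `Y`):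
  **`E_4(μ_p; 1_G, 1_D, 1_{X'}, 1_Y) ≥ 0`** — a frame `(K, K', Y)` with two members shrunk and one arbitrary event.
Everything proved; axioms standard. [this work]
-/

noncomputable section

open scoped Classical

namespace Summit.CriticalPhenomena.PercolationContinuityZ3.Theorems

open Finset Function
open Literature.Combinatorics.Sahi2008
open Literature.Probability.Percolation (DeterminedBy)
open Literature.Probability.Percolation.DecisionTree (ind ind_of_mem ind_of_not_mem ind_nonneg)

section Abstract

variable {α : Type*} [Fintype α]

omit [Fintype α] in
/-- Vector/`cons` form at order four. [folklore] -/
private theorem v4_cons (a b c d : α → ℝ) : (![a, b, c, d] : Fin 4 → α → ℝ) = Fin.cons a (Fin.cons b ![c, d]) := by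
  funext j; fin_cases j <;> rfl

omit [Fintype α] in
/-- Vector/`cons` form at order three. [folklore] -/
private theorem v3_cons (a b c : α → ℝ) : (![a, b, c] : Fin 3 → α → ℝ) = Fin.cons a ![b, c] := by
  funext j; fin_cases j <;> rfl

/-- `E_4(n, d, x, y) = −E(n)E_3(d,x,y) − E(dn)E_2(x,y)` and `E_3(n, x, y) = −E(n)E_2(x,y)` for `n` killing `x, y`. [this work] -/
theorem sahiE_four_three_of_annihilator (μ : α → ℝ) (n d x y : α → ℝ) (hx : x * n = 0) (hy : y * n = 0) :
    sahiE μ 4 ![n, d, x, y] = -(ex μ n * sahiE μ 3 ![d, x, y]) - ex μ (d * n) * sahiE μ 2 ![x, y] ∧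
      sahiE μ 3 ![n, x, y] = -(ex μ n * sahiE μ 2 ![x, y]) := by
  have hann : ∀ j : Fin 2, (![x, y] : Fin 2 → α → ℝ) j * n = 0 := by
    intro j; fin_cases j
    · exact hx
    · exact hy
  constructor
  · rw [v4_cons, sahiE_cons_cons_of_mul_eq_zero μ 1 n d ![x, y] hann, ← v3_cons]; ring
  · rw [v3_cons, SahiMeetTowerAll.sahiE_cons_of_mul_eq_zero μ 1 n ![x, y] hann]; ring

/-- Swapping the first two slots of `E_4`. [this work] -/
theorem sahiE_four_swap01 (μ : α → ℝ) (a b c d : α → ℝ) : sahiE μ 4 ![a, b, c, d] = sahiE μ 4 ![b, a, c, d] :=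
  sahiE_four_of_perm μ ![b, a, c, d] ![a, b, c, d] (Equiv.swap 0 1) fun j => by fin_cases j <;> rfl

/-- **Two shrunk slots at order four, any weight**: `g = k − n`, `d = k' − n'`, `n, n'` killing `x, y` ⇒
`E_4(g,d,x,y) = E_4(k,k',x,y) + E(n)E_3(k',x,y) + E(n')E_3(k,x,y) + [E(k'n) + E(kn') + E(n)E(n') − E(nn')]·E_2(x,y)`. [this work] -/
theorem sahiE_four_eq_of_two_shrinks (μ : α → ℝ) (g d x y k k' n n' : α → ℝ) (hg : g = k - n) (hd : d = k' - n')
    (hxn : x * n = 0) (hyn : y * n = 0) (hxn' : x * n' = 0) (hyn' : y * n' = 0) :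
    sahiE μ 4 ![g, d, x, y] = sahiE μ 4 ![k, k', x, y] + ex μ n * sahiE μ 3 ![k', x, y] + ex μ n' * sahiE μ 3 ![k, x, y]
      + (ex μ (k' * n) + ex μ (k * n') + ex μ n * ex μ n' - ex μ (n * n')) * sahiE μ 2 ![x, y] := by
  have u0 : ∀ (f b : α → ℝ), (![f, b, x, y] : Fin 4 → α → ℝ) = update ![g, b, x, y] 0 f := fun f b => by
    funext j; fin_cases j <;> rfl
  have u1 : ∀ (a f : α → ℝ), (![a, f, x, y] : Fin 4 → α → ℝ) = update ![a, d, x, y] 1 f := fun a f => by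
    funext j; fin_cases j <;> rfl
  have lin0 : ∀ b : α → ℝ, sahiE μ 4 ![g, b, x, y] = sahiE μ 4 ![k, b, x, y] - sahiE μ 4 ![n, b, x, y] := by
    intro b
    have key := sahiE_update_lin μ 4 (![g, b, x, y]) 0 1 (-1) k n
    rw [← u0, ← u0, ← u0, show (1 : ℝ) • k + (-1 : ℝ) • n = g by rw [hg, one_smul, neg_one_smul]; abel] at key
    rw [key]; ring
  have lin1 : ∀ a : α → ℝ, sahiE μ 4 ![a, d, x, y] = sahiE μ 4 ![a, k', x, y] - sahiE μ 4 ![a, n', x, y] := by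
    intro a
    have key := sahiE_update_lin μ 4 (![a, d, x, y]) 1 1 (-1) k' n'
    rw [← u1, ← u1, ← u1, show (1 : ℝ) • k' + (-1 : ℝ) • n' = d by rw [hd, one_smul, neg_one_smul]; abel] at key
    rw [key]; ring
  rw [lin0, lin1, lin1, sahiE_four_swap01 μ k n', (sahiE_four_three_of_annihilator μ n k' x y hxn hyn).1,
    (sahiE_four_three_of_annihilator μ n' k x y hxn' hyn').1, (sahiE_four_three_of_annihilator μ n n' x y hxn hyn).1,
    (sahiE_four_three_of_annihilator μ n' k x y hxn' hyn').2]
  have hc : n' * n = n * n' := mul_comm _ _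
  rw [hc]
  ring

end Abstract

section Events

variable {ι : Type} [Fintype ι]

/-- **`E_4 ≥ 0` for a pair frame with two shrunk slots and one arbitrary event.**  Let `Y, K, K'` be increasing events with
pairwise disjoint essential supports, `X'` any increasing event, and `G ⊆ K`, `D ⊆ K'` any events (not even monotone) with
`X' ∩ K ⊆ G`, `Y ∩ K ⊆ G`, `X' ∩ K' ⊆ D`, `Y ∩ K' ⊆ D`.  Then `0 ≤ E_4(μ_p; 1_G, 1_D, 1_{X'}, 1_Y)` for every `p ∈ [0,1]^ι`.
[this work] -/
theorem sahiE_four_ind_nonneg_of_two_shrinks (p : ι → unitInterval) {G D X' Y K K' : Set (Set ι)}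
    (hX : IsUpperSet X') (hY : IsUpperSet Y) (hK : IsUpperSet K) (hK' : IsUpperSet K')
    (dYK : Disjoint (esupp Y) (esupp K)) (dYK' : Disjoint (esupp Y) (esupp K')) (dKK' : Disjoint (esupp K) (esupp K'))
    (hGK : G ⊆ K) (hDK' : D ⊆ K') (hXG : X' ∩ K ⊆ G) (hYG : Y ∩ K ⊆ G) (hXD : X' ∩ K' ⊆ D) (hYD : Y ∩ K' ⊆ D) :
    0 ≤ sahiE (bernoulliWeight p) 4 ![ind G, ind D, ind X', ind Y] := by
  have ann : ∀ {A B C : Set (Set ι)}, A ∩ B ⊆ C → ind A * ind (B \ C) = 0 := by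
    intro A B C h
    refine ind_mul_ind_eq_zero_of_disjoint (Set.disjoint_left.2 fun ω hA hN => hN.2 (h ⟨hA, hN.1⟩))
  rw [sahiE_four_eq_of_two_shrinks (bernoulliWeight p) (ind G) (ind D) (ind X') (ind Y) (ind K) (ind K')
    (ind (K \ G)) (ind (K' \ D)) (by rw [ind_diff_eq_sub hGK]; ring) (by rw [ind_diff_eq_sub hDK']; ring)
    (ann hXG) (ann hYG) (ann hXD) (ann hYD)]
  -- the frame term: `(K, K', Y)` independent, `X'` free in slot 2
  have hU4 : ∀ j, IsUpperSet ((![K, K', X', Y] : Fin 4 → Set (Set ι)) j) := by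
    intro j; fin_cases j
    · exact hK
    · exact hK'
    · exact hX
    · exact hY
  have t1 : 0 ≤ sahiE (bernoulliWeight p) 4 ![ind K, ind K', ind X', ind Y] := by
    have h := sahiE_ind_nonneg_of_frame p ![K, K', X', Y] hU4 2 (by
      intro j j' hj hj' hne
      fin_cases j <;> fin_cases j' <;>
        first
        | exact absurd rfl hne
        | exact absurd rfl hj
        | exact absurd rfl hj'
        | exact dKK' | exact dKK'.symm | exact dYK.symm | exact dYK | exact dYK'.symm | exact dYK')
    have e1 : (fun j => ind ((![K, K', X', Y] : Fin 4 → Set (Set ι)) j)) = ![ind K, ind K', ind X', ind Y] := by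
      funext j; fin_cases j <;> rfl
    rwa [e1] at h
  -- `E_3(K', X', Y) ≥ 0`, `E_3(K, X', Y) ≥ 0`: independent pairs `(K', Y)`, `(K, Y)`
  have t2 : ∀ {L : Set (Set ι)}, IsUpperSet L → Disjoint (esupp Y) (esupp L) →
      0 ≤ sahiE (bernoulliWeight p) 3 ![ind L, ind X', ind Y] := by
    intro L hL dYL
    have hU3 : ∀ j, IsUpperSet ((![L, X', Y] : Fin 3 → Set (Set ι)) j) := by
      intro j; fin_cases j
      · exact hL
      · exact hX
      · exact hY
    have h := sahiE_three_ind_nonneg_of_indepPair p ![L, X', Y] hU3 1 (by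
      have e : (fun j => (![L, X', Y] : Fin 3 → Set (Set ι)) ((1 : Fin 3).succAbove j)) = ![L, Y] := by
        funext j; fin_cases j <;> rfl
      rw [e]; exact (suppZeroFlag_two_iff hL hY).2 dYL.symm)
    have e : (fun j => ind ((![L, X', Y] : Fin 3 → Set (Set ι)) j)) = ![ind L, ind X', ind Y] := by
      funext j; fin_cases j <;> rfl
    rwa [e] at h
  -- `E_2(X', Y) ≥ 0` (Harris)
  have t4 : 0 ≤ sahiE (bernoulliWeight p) 2 ![ind X', ind Y] := by
    have h := masterFamilyNonneg_of_le_two le_rfl ι p ![X', Y] (by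
      intro j; fin_cases j
      · exact hX
      · exact hY)
    have e : (fun j => ind ((![X', Y] : Fin 2 → Set (Set ι)) j)) = ![ind X', ind Y] := by
      funext j; fin_cases j <;> rfl
    rwa [e] at h
  have cN := ex_ind_nonneg' p (K \ G)
  have cN' := ex_ind_nonneg' p (K' \ D)
  have cKN' := ex_ind_mul_nonneg p K (K' \ D)
  have cmono := ex_ind_mul_le_of_subset p (N := K \ G) (N' := K' \ D) (K' := K') Set.sdiff_subset
  have hb : 0 ≤ ex (bernoulliWeight p) (ind K' * ind (K \ G)) + ex (bernoulliWeight p) (ind K * ind (K' \ D))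
      + ex (bernoulliWeight p) (ind (K \ G)) * ex (bernoulliWeight p) (ind (K' \ D))
      - ex (bernoulliWeight p) (ind (K \ G) * ind (K' \ D)) := by
    have := mul_nonneg cN cN'; linarith
  have := mul_nonneg cN (t2 hK' dYK'); have := mul_nonneg cN' (t2 hK dYK); have := mul_nonneg hb t4
  linarith

end Events

end Summit.CriticalPhenomena.PercolationContinuityZ3.Theorems
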